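import Summits.CriticalPhenomena.PercolationContinuityZ3.Theorems.PercNearOneGluingNoHeavyQuantFarSunCertTenFourB
import HarnessLib

/-!
# FAR beyond trees: **`HairyCycle.SunFAR 10 4`** — an exact reached-set-level two-copy certificate for the sun graph with `K = 10` hairs at layer `j = 4` (shared-products Kronecker check, sharded) — shard file 3/3 (`l ∈ {9,10}`)

builds on p205010 (kernel theorem, internal audit signed; external expert review pending)

Support file (`--supports stmt-CriticalPhenomena-4575`), seat `prim-cert-1` (gen 30; pipeline gen 26/28); memos `prim-cert-1/FROM-prim-cert-1-g26-CONFIG-CERTS.md`, `prim-cert-1/FROM-prim-cert-1-g28-TOP-LAYERS.md`.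
Shard 3 of 3 of the Kronecker check of the `(10,4)` certificate (`PercNearOneGluingNoHeavyQuantFarSunCertTenFour`): prefix lengths `l ∈ {9, 10}`
(1386 blocks; each shard file stays under the farm's elaboration budget).  COMPUTATIONAL (`native_decide`).  Assembles **`HairyCycle.sunFAR_ten_four : SunFAR 10 4`**.
[cite: KozmaNitzan2024, Lemma 2 (p. 6), Conjecture 3 (p. 15)] (context: the lower-tail family; FAR is this programme's statement).
-/

namespace Summit.CriticalPhenomena.PercolationContinuityZ3.Theorems.HairyCycle

namespace TK


/-- Core-inequality check of the `(10, 4)` certificate, shard `l ∈ {9, 10}` (1386 blocks), base `2^27` (computational;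
one `native_decide`, so the record banks are built once). [this work] -/
theorem cK104_s3 : ([9, 10].all fun l => kronL2 10 27 (mkSBanks 10 4 27 (mkNTabs 10 am104 bm104)) l) = true := by
  native_decide

end TK

/-- **FAR at layer `4` on the sun graph with `10` hairs, all weights: `SunFAR 10 4`** (exact reached-set-level two-copy certificate (kit j184881, Clarabel interior point of the feasibility LP on 400k-row samples + cut loop over all 9 373 521 orbit rows (843 → 165 → 15 → 0 violated), support restricted by the support lemma's rule L = K − j (5372 of 5648 mirror-classes), rounded to an exact certificate with denominator 6), checked by the sharded shared-products Kronecker checker). [this work] -/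
theorem sunFAR_ten_four : SunFAR 10 4 := by
  refine TK.sunFAR_of_kronL2' (s := 27) (by norm_num) TK.am104 TK.bm104 (TK.prefixInv_rl 10 TK.tabA104 TK.tabB104) TK.cN104 fun l hl => ?_
  have h1 := List.all_eq_true.1 TK.cK104_s1
  have h2 := List.all_eq_true.1 TK.cK104_s2
  have h3 := List.all_eq_true.1 TK.cK104_s3
  interval_cases l
  · exact h1 0 (by simp)
  · exact h1 1 (by simp)
  · exact h1 2 (by simp)
  · exact h1 3 (by simp)
  · exact h1 4 (by simp)
  · exact h1 5 (by simp)
  · exact h2 6 (by simp)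
  · exact h2 7 (by simp)
  · exact h2 8 (by simp)
  · exact h3 9 (by simp)
  · exact h3 10 (by simp)

end Summit.CriticalPhenomena.PercolationContinuityZ3.Theorems.HairyCycle
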